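import Mathlib
import Summits.Ventures.PercRepro2.Defs
import Summits.Ventures.PercRepro2.Graph
import Summits.Ventures.PercRepro2.Induced
import Summits.Ventures.PercRepro2.VdBKahn
import Summits.Ventures.PercRepro2.ReimerVdBK
import Summits.Ventures.PercRepro2.ReimerVdBKRegions
import Summits.Ventures.PercRepro2.ReimerVdBKZClosed

/-!
# The Z-reduction: (R-1.2) with `z ∈ X ∩ Y` is the reduced instance weighted on the neighbours of `z`
(blind cell PercRepro2, mine-c g45; `conjectures/MINE-C.md` §54.6 — part 2)

Part 1 (`ReimerVdBKZClosed`) showed: for an unmarked `z`, `ω` lies in the two-world event of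
`(A, X ∪ {z}; B, Y ∪ {z})` iff `ω` lies in the reduced event `delTwoWorld` (the worlds of `G − z`, which
are blind to the colours of the edges at `z`) and every edge at `z` points away from the world it is open
in.  Summing the second condition over the colours of the edges at `z` — one edge at a time, by the
involution that flips that edge (`sum_flip`, `sum_prod_flip`) — gives the identity

  `2^{#edges at z} · Φ(A, X ∪ {z}; B, Y ∪ {z}) = ∑_{ω ∈ delTwoWorld} ∏_{e at z} ([y_e ∉ K₁′] + [y_e ∉ K₂′])`

(`zReduction`, `awayFactor_sum`): the count with `z` in neither world is the reduced count weighted, for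
every edge `{z, y}`, by `0` if `y` is in both reduced worlds, `1` if in exactly one, `2` if in neither — the
frontier weights `(0, 1, 1, 2^k)` of `MINE-C.md` §54.6, with the multiplicity `k_y` appearing as a product
over parallel edges.  Iterated over `Z = X ∩ Y`, (R-1.2) is exactly «a Harris pair (Z = ∅) weighted by these
frontier weights».
-/

namespace Summit.Ventures.PercRepro2

namespace ReimerVdBK

open Classical

variable {V : Type*} {E : Type*} [Fintype E] [DecidableEq E] [Fintype V] [DecidableEq V]

/-! ## Summing over the colour of one edge, and over a set of edges -/

omit [Fintype V] [DecidableEq V] in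
/-- **Pairing by one edge**: if `Φ` and the first argument of `h` are blind to the edge `f`, then
`2 ∑_ω Φ ω · h ω (ω f) = ∑_ω Φ ω · (h ω true + h ω false)`. -/
theorem sum_flip (f : E) (Φ : Config E → ℚ) (h : Config E → Bool → ℚ)
    (hΦ : ∀ ω b, Φ (Function.update ω f b) = Φ ω)
    (hh : ∀ ω b b', h (Function.update ω f b') b = h ω b) :
    2 * ∑ ω : Config E, Φ ω * h ω (ω f) = ∑ ω : Config E, Φ ω * (h ω true + h ω false) := by
  -- the involution flipping `f`
  let σ : Equiv.Perm (Config E) :=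
    { toFun := fun ω => Function.update ω f (!ω f)
      invFun := fun ω => Function.update ω f (!ω f)
      left_inv := fun ω => by
        funext e
        by_cases he : e = f
        · subst he; simp
        · simp [Function.update_of_ne he]
      right_inv := fun ω => by
        funext e
        by_cases he : e = f
        · subst he; simp
        · simp [Function.update_of_ne he] }
  have hσ : ∀ ω, σ ω = Function.update ω f (!ω f) := fun ω => rfl
  have hsum : ∑ ω : Config E, Φ ω * h ω (ω f) =
      ∑ ω : Config E, Φ ω * h ω (!ω f) := by
    rw [← Equiv.sum_comp σ (fun ω => Φ ω * h ω (ω f))]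
    refine Finset.sum_congr rfl fun ω _ => ?_
    rw [hσ, hΦ, hh, Function.update_self]
  calc 2 * ∑ ω : Config E, Φ ω * h ω (ω f)
      = ∑ ω : Config E, Φ ω * h ω (ω f) + ∑ ω : Config E, Φ ω * h ω (!ω f) := by rw [← hsum]; ring
    _ = ∑ ω : Config E, Φ ω * (h ω (ω f) + h ω (!ω f)) := by
        rw [← Finset.sum_add_distrib]
        refine Finset.sum_congr rfl fun ω _ => ?_
        ring
    _ = ∑ ω : Config E, Φ ω * (h ω true + h ω false) := by
        refine Finset.sum_congr rfl fun ω _ => ?_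
        cases ω f <;> simp [add_comm]

omit [Fintype V] [DecidableEq V] in
/-- **Pairing by a set of edges**: if `Φ` and the first arguments of the `h e` are blind to every edge of
`F`, then `2^{|F|} ∑_ω Φ ω · ∏_{e ∈ F} h e ω (ω e) = ∑_ω Φ ω · ∏_{e ∈ F} (h e ω true + h e ω false)`. -/
theorem sum_prod_flip (F : Finset E) (Φ : Config E → ℚ) (h : E → Config E → Bool → ℚ)
    (hΦ : ∀ f ∈ F, ∀ ω b, Φ (Function.update ω f b) = Φ ω)
    (hh : ∀ e, ∀ f ∈ F, ∀ ω b b', h e (Function.update ω f b') b = h e ω b) :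
    (2 : ℚ) ^ F.card * ∑ ω : Config E, Φ ω * ∏ e ∈ F, h e ω (ω e) =
      ∑ ω : Config E, Φ ω * ∏ e ∈ F, (h e ω true + h e ω false) := by
  induction F using Finset.induction_on generalizing Φ with
  | empty => simp
  | insert f F hfF ih =>
    have hΦf : ∀ ω b, Φ (Function.update ω f b) = Φ ω := hΦ f (Finset.mem_insert_self f F)
    have hΦF : ∀ f' ∈ F, ∀ ω b, Φ (Function.update ω f' b) = Φ ω :=
      fun f' hf' => hΦ f' (Finset.mem_insert_of_mem hf')
    have hhF : ∀ e, ∀ f' ∈ F, ∀ ω b b', h e (Function.update ω f' b') b = h e ω b :=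
      fun e f' hf' => hh e f' (Finset.mem_insert_of_mem hf')
    -- the product over `F` is blind to `f`
    have hprod : ∀ ω b, (∏ e ∈ F, h e (Function.update ω f b) ((Function.update ω f b) e)) =
        ∏ e ∈ F, h e ω (ω e) := by
      intro ω b
      refine Finset.prod_congr rfl fun e he => ?_
      have hef : e ≠ f := fun h' => hfF (h' ▸ he)
      rw [hh e f (Finset.mem_insert_self f F), Function.update_of_ne hef]
    -- step 1: pair by `f`
    have step1 : 2 * ∑ ω : Config E, (Φ ω * ∏ e ∈ F, h e ω (ω e)) * h f ω (ω f) =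
        ∑ ω : Config E, (Φ ω * ∏ e ∈ F, h e ω (ω e)) * (h f ω true + h f ω false) :=
      sum_flip f (fun ω => Φ ω * ∏ e ∈ F, h e ω (ω e)) (h f)
        (fun ω b => by rw [hΦf, hprod]) (fun ω b b' => hh f f (Finset.mem_insert_self f F) ω b b')
    -- step 2: the induction hypothesis with `Φ · (h f true + h f false)`
    have step2 := ih (fun ω => Φ ω * (h f ω true + h f ω false))
      (fun f' hf' ω b => by
        rw [hΦF f' hf', hhF f f' hf', hhF f f' hf'])
      hhF
    rw [Finset.card_insert_of_notMem hfF, pow_succ]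
    have hS : ∑ ω : Config E, Φ ω * ∏ e ∈ insert f F, h e ω (ω e) =
        ∑ ω : Config E, (Φ ω * ∏ e ∈ F, h e ω (ω e)) * h f ω (ω f) :=
      Finset.sum_congr rfl fun ω _ => by rw [Finset.prod_insert hfF]; ring
    calc (2 : ℚ) ^ F.card * 2 * ∑ ω : Config E, Φ ω * ∏ e ∈ insert f F, h e ω (ω e)
        = (2 : ℚ) ^ F.card *
            (2 * ∑ ω : Config E, (Φ ω * ∏ e ∈ F, h e ω (ω e)) * h f ω (ω f)) := by
          rw [hS, mul_assoc]
      _ = (2 : ℚ) ^ F.card *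
            ∑ ω : Config E, (Φ ω * (h f ω true + h f ω false)) * ∏ e ∈ F, h e ω (ω e) := by
          rw [step1]
          congr 1
          refine Finset.sum_congr rfl fun ω _ => ?_
          ring
      _ = ∑ ω : Config E, (Φ ω * (h f ω true + h f ω false)) * ∏ e ∈ F, (h e ω true + h e ω false) :=
          step2
      _ = ∑ ω : Config E, Φ ω * ∏ e ∈ insert f F, (h e ω true + h e ω false) := by
          refine Finset.sum_congr rfl fun ω _ => ?_
          rw [Finset.prod_insert hfF]; ring

/-! ## The edges at `z` and the «points away» factor -/

variable (ends : E → Sym2 V) (s : V)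

/-- The edges at `z`. -/
def edgesAt (z : V) : Finset E := Finset.univ.filter (fun e => z ∈ ends e)

/-- The «points away» factor of the edge `e` at `z` with colour `b`: `1` if `e` with that colour does not
connect `z` to a reached vertex of the corresponding reduced world, `0` otherwise. -/
def awayFactor (z : V) (e : E) (ω : Config E) (b : Bool) : ℚ :=
  if (∀ y, ends e = s(z, y) → (b = true → ¬ Conn ends (closeAt ends z ω) s y) ∧
      (b = false → ¬ Conn ends (closeAt ends z (compl ω)) s y)) then 1 else 0

/-- The factor is blind to the colours of the edges at `z`. -/
lemma awayFactor_update {z : V} (e : E) (ω : Config E) {f : E} (hf : z ∈ ends f) (b b' : Bool) :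
    awayFactor ends s z e (Function.update ω f b') b = awayFactor ends s z e ω b := by
  unfold awayFactor
  rw [closeAt_update ends ω hf b', closeAt_compl_update ends ω hf b']

omit [DecidableEq E] in
/-- For an edge not at `z` the factor is `1` (the condition is vacuous). -/
lemma awayFactor_of_notMem {z : V} {e : E} (he : z ∉ ends e) (ω : Config E) (b : Bool) :
    awayFactor ends s z e ω b = 1 := by
  unfold awayFactor
  rw [if_pos]
  intro y hy
  exact absurd (by rw [hy]; exact Sym2.mem_mk_left z y) he

omit [DecidableEq E] in
/-- `zAway` is the product of the factors at the actual colours. -/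
lemma zAway_iff_prod (z : V) (ω : Config E) :
    zAway ends s z ω ↔ ∏ e ∈ edgesAt ends z, awayFactor ends s z e ω (ω e) = 1 := by
  constructor
  · intro h
    refine Finset.prod_eq_one fun e _ => ?_
    unfold awayFactor
    rw [if_pos]
    intro y hy
    exact h e y hy
  · intro h e y hy
    have he : e ∈ edgesAt ends z := by
      simp only [edgesAt, Finset.mem_filter, Finset.mem_univ, true_and]
      rw [hy]; exact Sym2.mem_mk_left z y
    have hfac : awayFactor ends s z e ω (ω e) = 1 := by
      by_contra hne
      have h0 : awayFactor ends s z e ω (ω e) = 0 := by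
        unfold awayFactor at hne ⊢
        split_ifs at hne ⊢ with hc
        · exact absurd rfl hne
        · rfl
      have : ∏ e' ∈ edgesAt ends z, awayFactor ends s z e' ω (ω e') = 0 :=
        Finset.prod_eq_zero he h0
      rw [this] at h
      exact zero_ne_one h
    unfold awayFactor at hfac
    split_ifs at hfac with hc
    · exact hc y hy
    · exact absurd hfac zero_ne_one

omit [DecidableEq E] in
/-- The two factors of an edge `{z, y}` with `y ≠ z` sum to `[y ∉ K₁′] + [y ∉ K₂′]` — the weight `0 / 1 / 2`
of the reduced type of `y` (both worlds / one world / neither). -/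
theorem awayFactor_sum {z y : V} {e : E} (hends : ends e = s(z, y)) (hyz : y ≠ z) (ω : Config E) :
    awayFactor ends s z e ω true + awayFactor ends s z e ω false =
      (if Conn ends (closeAt ends z ω) s y then 0 else 1) +
        (if Conn ends (closeAt ends z (compl ω)) s y then 0 else 1) := by
  have huniq : ∀ y', ends e = s(z, y') → y' = y := by
    intro y' hy'
    rw [hends, Sym2.eq_iff] at hy'
    rcases hy' with ⟨_, h⟩ | ⟨_, h2⟩
    · exact h.symm
    · exact absurd h2 hyz
  unfold awayFactor
  have h1 : (∀ y', ends e = s(z, y') → (true = true → ¬ Conn ends (closeAt ends z ω) s y') ∧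
      (true = false → ¬ Conn ends (closeAt ends z (compl ω)) s y')) ↔
      ¬ Conn ends (closeAt ends z ω) s y := by
    constructor
    · intro h; exact (h y hends).1 rfl
    · intro h y' hy'; rw [huniq y' hy']; exact ⟨fun _ => h, fun h' => absurd h' (by decide)⟩
  have h2 : (∀ y', ends e = s(z, y') → (false = true → ¬ Conn ends (closeAt ends z ω) s y') ∧
      (false = false → ¬ Conn ends (closeAt ends z (compl ω)) s y')) ↔
      ¬ Conn ends (closeAt ends z (compl ω)) s y := by
    constructor
    · intro h; exact (h y hends).2 rfl
    · intro h y' hy'; rw [huniq y' hy']; exact ⟨fun h' => absurd h' (by decide), fun _ => h⟩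
  rw [if_congr h1 rfl rfl, if_congr h2 rfl rfl]
  by_cases c1 : Conn ends (closeAt ends z ω) s y <;>
    by_cases c2 : Conn ends (closeAt ends z (compl ω)) s y <;> simp [c1, c2]

/-! ## The Z-reduction -/

/-- **The Z-reduction**: for an unmarked `z ≠ s`, `2^{#edges at z} · Φ(A, X ∪ {z}; B, Y ∪ {z})` equals the
reduced two-world count of `(A, X; B, Y)` (worlds `closeAt z ω`, `closeAt z (compl ω)`) weighted by the
product over the edges at `z` of `awayFactor true + awayFactor false` — by `awayFactor_sum`, the weight
`0 / 1 / 2` of the reduced type of the other endpoint, i.e. `(0, 1, 1, 2^k)` per neighbour with `k` parallel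
edges (and `2` per loop). -/
theorem zReduction {z : V} {A X B Y : Finset V} (hz : z ∉ A ∪ X ∪ B ∪ Y) (hsz : s ≠ z) :
    (2 : ℚ) ^ (edgesAt ends z).card * (reimerCount ends s A (insert z X) B (insert z Y) : ℚ) =
      ∑ ω : Config E, (if ω ∈ delTwoWorld ends s z A X B Y then 1 else 0) *
        ∏ e ∈ edgesAt ends z, (awayFactor ends s z e ω true + awayFactor ends s z e ω false) := by
  have hmem : ∀ f ∈ edgesAt ends z, z ∈ ends f := by
    intro f hf; simpa [edgesAt] using hf
  rw [← sum_prod_flip (edgesAt ends z) (fun ω => if ω ∈ delTwoWorld ends s z A X B Y then 1 else 0)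
    (fun e ω b => awayFactor ends s z e ω b)
    (fun f hf ω b => by
      by_cases h : ω ∈ delTwoWorld ends s z A X B Y
      · rw [if_pos h, if_pos ((mem_delTwoWorld_update_iff ends s A X B Y ω (hmem f hf) b).2 h)]
      · rw [if_neg h, if_neg (fun h' => h ((mem_delTwoWorld_update_iff ends s A X B Y ω (hmem f hf) b).1 h'))])
    (fun e f hf ω b b' => awayFactor_update ends s e ω (hmem f hf) b b')]
  congr 1
  unfold reimerCount count
  push_cast
  refine Finset.sum_congr rfl fun ω _ => ?_
  rw [mem_twoWorld_insert_iff_del ends s hz hsz ω]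
  by_cases hd : ω ∈ delTwoWorld ends s z A X B Y
  · by_cases ha : zAway ends s z ω
    · rw [if_pos ⟨hd, ha⟩, if_pos hd, (zAway_iff_prod ends s z ω).1 ha]; ring
    · rw [if_neg (fun h => ha h.2), if_pos hd]
      have : ∏ e ∈ edgesAt ends z, awayFactor ends s z e ω (ω e) = 0 := by
        by_contra hne
        apply ha
        rw [zAway_iff_prod]
        -- a product of `0 / 1` factors is `0` or `1`
        have hall : ∀ e ∈ edgesAt ends z, awayFactor ends s z e ω (ω e) = 1 := by
          intro e he
          by_contra h1
          apply hne
          refine Finset.prod_eq_zero he ?_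
          unfold awayFactor at h1 ⊢
          split_ifs at h1 ⊢
          · exact absurd rfl h1
          · rfl
        exact Finset.prod_eq_one hall
      rw [this]; ring
  · rw [if_neg (fun h => hd h.1), if_neg hd]; ring

end ReimerVdBK

end Summit.Ventures.PercRepro2
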